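import Literature.NumberTheory.Automorphic.FreitasLeHungSiksekModularity
import HarnessLib

/-!
# Modularity of elliptic curves over totally real fields of small degree
# (Freitas–Le Hung–Siksek 2015, Thms. 1 and 5; Derickx–Najman–Siksek 2020, Thm. 4; Box 2022, Thm. 1.1)

Topic `Literature/NumberTheory/Automorphic` (reciprocity for `GL₂` over totally real fields;
companion of `CaraianiNewtonModularity.lean` — the imaginary quadratic analogue — and of
`ReciprocityGLnPotentialModularity.lean`, whose vocabulary `CuspidalAutomorphicRepData`,
`HasWeightZero`, `HasHeckePolynomialAt`, `frobPoly`, `frobTraceAt`, `IsAutomorphicOfWeightZero`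
we follow verbatim). Grounds the route crux
`Summit.Langlands.Langlands.Theses.AdjointEulerNumerical.TotallyRealWeightZeroAutomorphic`
(ledger stmt-Langlands-2176: ALL elliptic curves over ALL totally real fields), recording what is
PRINTED today: degree `2` (FLS 2015), degree `3` (DNS 2020), degree `4` without `√5` (Box 2022),
and "all but finitely many `j`-invariants" over any totally real field (FLS 2015, Thm. 5), all
with conclusion the tree's `IsAutomorphicOfWeightZero E`; plus the cofinite weak form
`IsHilbertModular` with two proved bridges.

**Relation to `FreitasLeHungSiksekModularity.lean` (landed the same day, 2026-08-15).** That file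
already vendors FLS Thms. 1 and 5 as `FreitasLeHungSiksek2015_thm1` / `_thm5` with the WEAKER
trace-only conclusion `IsModularEllipticCurve K E` (CM escape ∨ cofinite trace matching). The strong
forms `FLS2015_theorem1` / `FLS2015_theorem5` below imply them — proved here as
`FLS2015_theorem1.toWeak` and `FLS2015_theorem5.toWeak` through the two bridges — so the pair of
facts for each printed theorem is ONE unit of debt in content. refactor: retire
`FreitasLeHungSiksek2015_thm1` / `_thm5` in favour of the strong forms (consumers switch by
composing with `.toWeak`), at a librarian's convenience.

## What the sources print (quoted from the held texts)

* N. Freitas, B. V. Le Hung, S. Siksek, *Elliptic curves over real quadratic fields are modular*,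
  Invent. Math. 201 (2015) 159–206 = arXiv:1310.7088 [FreitasLeHungSiksek2015], §1:
  "Let `K` be a totally real number field … Let `E` be an elliptic curve over `K`. Recall that
  `E` is modular if there exists a Hilbert cuspidal eigenform `𝔣` over `K` of parallel weight
  `2`, with rational Hecke eigenvalues, such that the Hasse–Weil L-function of `E` is equal to the
  L-function of `𝔣`. A more conceptual way to phrase this is that there is an isomorphism of
  compatible systems of Galois representations `ρ_{E,p} ≅ ρ_{𝔣,p}`."
  **Theorem 1.** "Let `E` be an elliptic curve over a real quadratic field `K`. Then `E` is
  modular."  **Theorem 5.** "Let `K` be a totally real field. All but finitely many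
  `K̄`-isomorphism classes of elliptic curves over `K` are modular."
  (Thms. 2–4 of the source — modularity from `ρ̄_{E,p}(G_{K(ζ_p)})` absolutely irreducible,
  `p = 3, 5, 7` — are NOT vendored: no carrier for the residual image condition over `K`.)
* M. Derickx, F. Najman, S. Siksek, *Elliptic curves over totally real cubic fields are modular*,
  Algebra Number Theory 14 (2020) 1791–1800 = arXiv:1901.03436 [DerickxNajmanSiksek2020], §1:
  "there is a level `𝒩` Hilbert newform `𝔣` over `K` of parallel weight `2` and rational Hecke
  eigenvalues such that `L(E,s) = L(𝔣,s)`" (definition of modular, `𝒩` = conductor of `E`);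
  **Theorem 4.** "Let `K` be a totally real cubic number field. Let `E` be an elliptic curve over
  `K`. Then `E` is modular."
* J. Box, *Elliptic curves over totally real quartic fields not containing `√5` are modular*,
  Trans. Amer. Math. Soc. 375 (2022) = arXiv:2103.13975 [Box2022], §1: "We say that an elliptic
  curve `E` over `K` of conductor `𝒩` is modular when there is a Hilbert newform `𝔣` of level `𝒩`,
  parallel weight `2` and with rational Hecke eigenvalues, such that their corresponding systems of
  compatible `ℓ`-adic Galois representations are isomorphic."  **Theorem 1.1.** "Let `E` be an
  elliptic curve over a totally real quartic number field not containing a square root of `5`.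
  Then `E` is modular."

## Rendering and faithfulness

* "modular" is rendered by the tree's EXISTING predicate `IsAutomorphicOfWeightZero E`
  (`ReciprocityGLnPotentialModularity.lean`) for an integral Weierstrass model `E` over `𝓞 K`: a
  cuspidal automorphic representation `π` of `GL₂(𝔸_K)` of weight zero (`HasWeightZero`:
  cohomological for the trivial coefficient system = the representation generated by a Hilbert
  cusp form of parallel weight `2`) whose Hecke polynomial at EVERY finite place `w ∤ Δ(E)` is
  `X² - a_w(E) X + q_w` (`HasHeckePolynomialAt`, Clozel / Harris–Taylor normalisation
  `rec(π_w |det|^{-1/2})`). Why this is what the sources print (review of 2026-08-15): the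
  printed newform `𝔣` has level `𝒩` = conductor of `E` (DNS §1, Box §1; for FLS §1 the equality
  `L(E,s) = L(𝔣,s)` of Euler products over the places of `K`, equivalently `ρ_{E,p} ≅ ρ_{𝔣,p}` as
  compatible systems, carries the same information), so `π_w` is unramified at every `w ∤ 𝒩`, in
  particular at every `w ∤ Δ(E)` (the model has good reduction there, so `w ∤ 𝒩`); for such `w`
  and `p ∤ w` the Hecke polynomial of `π_w` is the characteristic polynomial of `ρ_{𝔣,p}(Frob_w)`
  (Taylor 1989, the defining property of `ρ_{𝔣,p}` quoted by all three sources), which by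
  `ρ_{E,p} ≅ ρ_{𝔣,p}` is that of `ρ_{E,p}(Frob_w)`, i.e. `X² - a_w X + q_w` (Silverman V.2.3.1;
  `a_w = frobTraceAt E w` because an integral model with `w ∤ Δ` is minimal at `w`, Silverman
  VII.1.3); varying `p` removes the restriction `p ∤ w`. "Rational Hecke eigenvalues" is dropped
  (weaker, and implied by the matching anyway).
* The cofinite shadow `IsHilbertModular E` (Hecke polynomial `X² - a_w X + q_w` at all but
  finitely many `w`) is kept as the derived weak form, with the proved bridges
  `IsHilbertModular.of_isAutomorphicOfWeightZero` and `IsHilbertModular.isModularEllipticCurve`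
  (to the trace-only Caraiani–Newton rendering `IsModularEllipticCurve`, which has a CM escape).
* Fields: `NumberField K`, `NumberField.IsTotallyReal K`, `Module.finrank ℚ K = d`; Box's
  "not containing a square root of `5`" is `¬ IsSquare (5 : K)`.
* "every elliptic curve over `K`" = every Weierstrass model over `𝓞 K` with `Δ ≠ 0` (as in
  lang.S28 and `CaraianiNewton2023_modularity`; `Δ ≠ 0` also excludes the junk model for which
  `IsAutomorphicOfWeightZero` constrains no place); "`K̄`-isomorphism class" = `j`-invariant,
  `j(E) = c₄³ / Δ ∈ K` (Silverman III.1.4(b)), written out to avoid an `IsElliptic` instance on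
  the base change. Modularity is invariant under twisting, so "the class of `E` is modular" is
  "every `E` in the class is modular", and quantifying over all integral models with `Δ ≠ 0` and
  `j ∉ S` is faithful.
* The route crux `TotallyRealWeightZeroAutomorphic` (all totally real `F`, conclusion
  `IsAutomorphicOfWeightZero`) is, in degrees `2`, `3` and `4` without `√5`, literally
  `FLS2015_theorem1`, `DNS2020_theorem4`, `Box2022_theorem1_1` specialised; it is STRONGER than
  print in every other degree (FLS Thm. 5 gives only cofinitely many `j` per field).

## References

* [FreitasLeHungSiksek2015] Invent. Math. 201 (2015) 159–206, §1 (definition; Thms. 1, 5) —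
  held `paper:arxiv-1310.7088`, pp. 4–5 of the text.
* [DerickxNajmanSiksek2020] Algebra Number Theory 14 (2020) 1791–1800, §1 Thm. 4 — held
  `paper:arxiv-1901.03436`, p. 3 of the text.
* [Box2022] Trans. AMS 375 (2022), doi:10.1090/tran/8557, Thm. 1.1 — held
  `paper:arxiv-2103.13975`, p. 3 of the text.
* [ACCGHLNSTT2023] §7.1 (shape of "automorphic compatible system", via
  `ReciprocityGLnPotentialModularity`); [CaraianiNewton2023] (sibling rendering).
-/

open scoped NumberField Polynomial
open NumberField IsDedekindDomain Filter

noncomputable section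

namespace Literature.NumberTheory.Automorphic

/-! ### The cofinite weak form of "`E` is modular" over a totally real field -/

/-- **`E / K` is (Hilbert) modular, cofinite form** — the weak shadow of "modular" in
Freitas–Le Hung–Siksek 2015 §1, Derickx–Najman–Siksek 2020 §1 and Box 2022 §1 (`ρ_{E,p} ≅ ρ_{𝔣,p}`
for a Hilbert newform `𝔣` of parallel weight `2`), read at all but finitely many places on the
tree's Borel–Jacquet data: for the integral Weierstrass model `E` over `𝓞 K` there are `hK` (the
compactness Prop typing `π`) and a cuspidal automorphic representation `π` of `GL₂(𝔸_K)` of weight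
zero (`HasWeightZero`, parallel weight `2`) such that at all but finitely many finite places `w`,
`π_w` is unramified with Hecke polynomial `X² - a_w(E) X + q_w` (`HasHeckePolynomialAt`,
`a_w = frobTraceAt E w`). The named facts below conclude the STRONGER tree predicate
`IsAutomorphicOfWeightZero` (every `w ∤ Δ(E)`); this weak form is what survives a change of
integral model at finitely many places, see `IsHilbertModular.of_isAutomorphicOfWeightZero`.
[cite: FreitasLeHungSiksek2015, §1 (definition of modular)] [cite: Box2022, §1] -/
def IsHilbertModular {K : Type} [Field K] [NumberField K] (E : WeierstrassCurve (𝓞 K)) : Prop :=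
  ∃ (hK : isCompact_glFiniteIntegralLevel 2 K) (π : CuspidalAutomorphicRepData 2 K hK),
    π.1.HasWeightZero ∧
      ∀ᶠ w : HeightOneSpectrum (𝓞 K) in cofinite,
        π.1.HasHeckePolynomialAt w
          ((frobPoly (frobTraceAt E w) w.residueCard).map (Int.castRingHom ℂ))

/-- The tree's stronger notion implies Hilbert modularity: if the model `E` (`Δ ≠ 0`) is
automorphic of weight zero (`IsAutomorphicOfWeightZero`: Hecke polynomial at every `w ∤ Δ(E)`),
then it is modular in the present cofinite sense (`eventually_not_mem_asIdeal`). [folklore] -/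
theorem IsHilbertModular.of_isAutomorphicOfWeightZero {K : Type} [Field K] [NumberField K]
    {E : WeierstrassCurve (𝓞 K)} (hΔ : E.Δ ≠ 0) (h : IsAutomorphicOfWeightZero E) :
    IsHilbertModular E := by
  obtain ⟨hK, π, h0, hH⟩ := h
  refine ⟨hK, π, h0, ?_⟩
  filter_upwards [eventually_not_mem_asIdeal hΔ] with w hw
  exact hH w hw

/-- Hilbert modularity implies modularity in the (trace-only) sense of Caraiani–Newton
(`IsModularEllipticCurve`, second alternative), by reading the quadratic Hecke polynomial
(`exists_hasSatakeParamAt_of_hasHeckePolynomialAt_frobPoly`). [folklore] -/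
theorem IsHilbertModular.isModularEllipticCurve {K : Type} [Field K] [NumberField K]
    {E : WeierstrassCurve (𝓞 K)} (h : IsHilbertModular E) : IsModularEllipticCurve K E := by
  obtain ⟨hK, π, h0, hH⟩ := h
  refine Or.inr ⟨hK, π, h0, ?_⟩
  filter_upwards [hH] with w hw
  obtain ⟨α, hα, hsum, -⟩ := exists_hasSatakeParamAt_of_hasHeckePolynomialAt_frobPoly hw
  exact ⟨α, hα, hsum⟩

/-! ### The named facts -/

/-- **Freitas–Le Hung–Siksek (2015), Theorem 1: elliptic curves over real quadratic fields are
modular.** "Let `E` be an elliptic curve over a real quadratic field `K`. Then `E` is modular."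
Rendered: for every totally real number field `K` of degree `2` and every Weierstrass model `E`
over `𝓞 K` with `Δ(E) ≠ 0`, `IsAutomorphicOfWeightZero E` — a weight-zero cuspidal `π` of
`GL₂(𝔸_K)` with Hecke polynomial `X² - a_w X + q_w` at every `w ∤ Δ(E)` (module docstring,
"Rendering": level of `𝔣` = conductor, Taylor's characterisation of `ρ_{𝔣,p}`). CM curves are
included (as printed). A named fact (D-0014): users take `(h : FLS2015_theorem1)`.
Grounds `Summit.Langlands.Langlands.Theses.AdjointEulerNumerical.TotallyRealWeightZeroAutomorphic`
in degree `2` (that item = this fact specialised; the item is stronger only in ranging over all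
degrees). [cite: FreitasLeHungSiksek2015, Thm. 1] -/
def FLS2015_theorem1 : Prop :=
  ∀ (K : Type) [Field K] [NumberField K] [IsTotallyReal K], Module.finrank ℚ K = 2 →
    ∀ E : WeierstrassCurve (𝓞 K), E.Δ ≠ 0 → IsAutomorphicOfWeightZero E

/-- **Freitas–Le Hung–Siksek (2015), Theorem 5: over a totally real field all but finitely many
`j`-invariants are modular.** "Let `K` be a totally real field. All but finitely many
`K̄`-isomorphism classes of elliptic curves over `K` are modular." Rendered: for every totally real
number field `K` there is a finite set `S ⊆ K` such that every Weierstrass model `E` over `𝓞 K`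
with `Δ(E) ≠ 0` and `j(E) = c₄(E)³ / Δ(E) ∉ S` is automorphic of weight zero
(`IsAutomorphicOfWeightZero E`; `K̄`-isomorphism classes of elliptic curves over `K` are classified
by `j ∈ K`, Silverman III.1.4(b), and modularity is twist-invariant, so "the class is modular" =
"every curve in it is modular"). The source's proof: non-modular `E` give `K`-points on one of 27
modular curves `X(u,v,w)` of genus `> 1` (Faltings). A named fact (D-0014).
[cite: FreitasLeHungSiksek2015, Thm. 5] -/
def FLS2015_theorem5 : Prop :=
  ∀ (K : Type) [Field K] [NumberField K] [IsTotallyReal K],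
    ∃ S : Finset K, ∀ E : WeierstrassCurve (𝓞 K), E.Δ ≠ 0 →
      (algebraMap (𝓞 K) K E.c₄) ^ 3 / algebraMap (𝓞 K) K E.Δ ∉ S → IsAutomorphicOfWeightZero E

/-- The strong form of FLS Thm. 1 implies the trace-only form `FreitasLeHungSiksek2015_thm1` of
`FreitasLeHungSiksekModularity.lean` (via `IsHilbertModular.of_isAutomorphicOfWeightZero` and
`IsHilbertModular.isModularEllipticCurve`). [cite: FreitasLeHungSiksek2015, Thm. 1] -/
theorem FLS2015_theorem1.toWeak (h : FLS2015_theorem1) : FreitasLeHungSiksek2015_thm1 :=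
  fun K _ _ _ hd E hE =>
    (IsHilbertModular.of_isAutomorphicOfWeightZero hE (h K hd E hE)).isModularEllipticCurve

/-- The strong form of FLS Thm. 5 implies the trace-only form `FreitasLeHungSiksek2015_thm5` of
`FreitasLeHungSiksekModularity.lean` (same finite exceptional set of `j`-invariants).
[cite: FreitasLeHungSiksek2015, Thm. 5] -/
theorem FLS2015_theorem5.toWeak (h : FLS2015_theorem5) : FreitasLeHungSiksek2015_thm5 := by
  intro K _ _ _
  obtain ⟨S, hS⟩ := h K
  exact ⟨S, fun E hE hj =>
    (IsHilbertModular.of_isAutomorphicOfWeightZero hE (hS E hE hj)).isModularEllipticCurve⟩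

/-- **Derickx–Najman–Siksek (2020), Theorem 4: elliptic curves over totally real cubic fields are
modular.** "Let `K` be a totally real cubic number field. Let `E` be an elliptic curve over `K`.
Then `E` is modular" (modular, §1: "a level `𝒩` Hilbert newform `𝔣` over `K` of parallel weight
`2` and rational Hecke eigenvalues such that `L(E,s) = L(𝔣,s)`", `𝒩` the conductor of `E`).
Rendered as for `FLS2015_theorem1` with `[K : ℚ] = 3` and conclusion `IsAutomorphicOfWeightZero E`.
A named fact (D-0014). [cite: DerickxNajmanSiksek2020, Thm. 4] -/
def DNS2020_theorem4 : Prop :=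
  ∀ (K : Type) [Field K] [NumberField K] [IsTotallyReal K], Module.finrank ℚ K = 3 →
    ∀ E : WeierstrassCurve (𝓞 K), E.Δ ≠ 0 → IsAutomorphicOfWeightZero E

/-- **Box (2022), Theorem 1.1: elliptic curves over totally real quartic fields not containing
`√5` are modular.** "Let `E` be an elliptic curve over a totally real quartic number field not
containing a square root of `5`. Then `E` is modular" (modular, §1: "a Hilbert newform `𝔣` of
level `𝒩`, parallel weight `2` and with rational Hecke eigenvalues, such that their corresponding
systems of compatible `ℓ`-adic Galois representations are isomorphic", `𝒩` the conductor of `E`).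
Rendered as for `FLS2015_theorem1` with `[K : ℚ] = 4`, `¬ IsSquare (5 : K)` and conclusion
`IsAutomorphicOfWeightZero E`. A named fact (D-0014). [cite: Box2022, Thm. 1.1] -/
def Box2022_theorem1_1 : Prop :=
  ∀ (K : Type) [Field K] [NumberField K] [IsTotallyReal K], Module.finrank ℚ K = 4 →
    ¬ IsSquare (5 : K) → ∀ E : WeierstrassCurve (𝓞 K), E.Δ ≠ 0 → IsAutomorphicOfWeightZero E

end Literature.NumberTheory.Automorphic

end

/-! ### Derickx–Najman–Siksek 2020, Theorem 4: bookkeeping around the named fact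

No discharge `DNS2020_theorem4_holds` is possible in the tree today. The printed proof
([DerickxNajmanSiksek2020], §§2–7, read in the held text `paper:arxiv-1901.03436`) rests on: the
modularity lifting criterion "`ρ̄_{E,p}(G_{K(ζ_p)})` absolutely irreducible for some
`p ∈ {3, 5, 7}` ⇒ modular" (its Thm. 1: "easily deduced from" the modularity lifting theorems of
Breuil–Diamond, Kisin, Gee and Barnet-Lamb–Gee–Geraghty "and by now standard modularity switching
arguments due to Wiles and to Manoharmayum", a proof being given in [FreitasLeHungSiksek2015]);
Thorne's theorem (its Thm. 5, Math. Ann. 364 (2016): `√5 ∉ K` and `ρ̄_{E,5}` irreducible ⇒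
modular) and Kalyanswamy's (its Thm. 6, `p = 7`, `K ∩ ℚ(ζ₇) = ℚ`); the
passage from small mod-`p` images to non-cuspidal `K`-points on the modular curves
`X(b5,b7) = X₀(35)` and `X(b5,ns7)` (its Prop. 2.1); and the determination, by computer algebra,
of the cubic points on these curves (its Thms. 7 and 8: `J₀(35)(ℚ) ≅ ℤ/24 ⊕ ℤ/2` and the
Riemann–Roch spaces of the `48` degree-`3` classes; Le Hung's decomposition of `J(b5,ns7)`,
Kolyvagin–Logachëv, a Mordell–Weil sieve on `X^{(3)}(𝔽₃)` and the
Derickx–Kamienny–Stein–Stoll formal immersion criterion) and on `X(b3,b5)`, `X(s3,b5)` over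
`ℚ(ζ₇)⁺` (its Lemma 3.1). None of these objects (mod-`p` Galois images of `E`, modular curves
with their moduli interpretation and Jacobians, Hilbert newforms and their dictionary with
`CuspidalAutomorphicRepData`) has a carrier in Mathlib or `Literature`, and no declaration of the
tree constructs a cusp form on `GL₂(𝔸_K)`; the fact therefore stays a cited named hypothesis
(D-0014). The three one-line theorems below are the formal bookkeeping around it, parallel to
`FLS2015_theorem1.toWeak` above and to
`FreitasLeHungSiksek2015_thm1_of_forall_isAutomorphicOfWeightZero` of the sibling file
`FreitasLeHungSiksekModularity.lean`: the fact implies the cofinite weak form `IsHilbertModular`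
and the trace-only form `IsModularEllipticCurve` in degree `3`, and it is implied by (it is the
degree-`3` specialisation of) the summit-side shape "every integral model with `Δ ≠ 0` over every
totally real field is automorphic of weight zero" (the crux `TotallyRealWeightZeroAutomorphic` of
route Langlands/AdjointEulerNumerical, module docstring "Rendering and faithfulness"). -/

namespace Literature.NumberTheory.Automorphic

/-- **DNS 2020, Thm. 4 ⇒ Hilbert modularity (cofinite form) over totally real cubic fields**:
from `DNS2020_theorem4`, every integral Weierstrass model `E` with `Δ(E) ≠ 0` over a totally real
cubic number field is modular in the cofinite sense `IsHilbertModular E`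
(`IsHilbertModular.of_isAutomorphicOfWeightZero`). [cite: DerickxNajmanSiksek2020, Thm. 4] -/
theorem DNS2020_theorem4.isHilbertModular (h : DNS2020_theorem4) (K : Type) [Field K]
    [NumberField K] [IsTotallyReal K] (hd : Module.finrank ℚ K = 3)
    (E : WeierstrassCurve (𝓞 K)) (hE : E.Δ ≠ 0) : IsHilbertModular E :=
  IsHilbertModular.of_isAutomorphicOfWeightZero hE (h K hd E hE)

/-- **DNS 2020, Thm. 4 ⇒ modularity in the trace-only sense of Caraiani–Newton** over totally
real cubic fields: from `DNS2020_theorem4`, every integral model `E` with `Δ(E) ≠ 0` over a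
totally real cubic number field `K` satisfies `IsModularEllipticCurve K E` (second alternative: a
weight-zero cuspidal `π` of `GL₂(𝔸_K)` whose `T_w`-eigenvalue is `a_w(E)` at all but finitely
many `w`), via `IsHilbertModular.isModularEllipticCurve`. [cite: DerickxNajmanSiksek2020, Thm. 4] -/
theorem DNS2020_theorem4.isModularEllipticCurve (h : DNS2020_theorem4) (K : Type) [Field K]
    [NumberField K] [IsTotallyReal K] (hd : Module.finrank ℚ K = 3)
    (E : WeierstrassCurve (𝓞 K)) (hE : E.Δ ≠ 0) : IsModularEllipticCurve K E :=
  (h.isHilbertModular K hd E hE).isModularEllipticCurve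

/-- **The summit-side shape implies DNS 2020, Thm. 4 as vendored.** If every integral model with
`Δ ≠ 0` over every totally real number field is automorphic of weight zero
(`IsAutomorphicOfWeightZero`; the statement of the crux `TotallyRealWeightZeroAutomorphic` of
route Langlands/AdjointEulerNumerical), then `DNS2020_theorem4` holds: the fact is literally the
degree-`3` specialisation of that shape, so the crux is at least as strong as the printed theorem
in degree `3`. This is NOT a discharge of the fact. [folklore] -/
theorem DNS2020_theorem4_of_forall_isAutomorphicOfWeightZero
    (h : ∀ (K : Type) [Field K] [NumberField K] [IsTotallyReal K],
      ∀ E : WeierstrassCurve (𝓞 K), E.Δ ≠ 0 → IsAutomorphicOfWeightZero E) :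
    DNS2020_theorem4 :=
  fun K _ _ _ _ E hE => h K E hE

end Literature.NumberTheory.Automorphic
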